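import Literature.NumberTheory.LFunctions.BettinChandee2018TrilinearKloostermanFractions
import Literature.NumberTheory.LFunctions.TrilinearKloostermanFractionsTools
import Literature.NumberTheory.LFunctions.TrilinearKloostermanFractionsFromC1
import Literature.NumberTheory.LFunctions.TrilinearKloostermanFractionsFromCb
import Literature.NumberTheory.LFunctions.TrilinearKloostermanFractionsFrom51
import HarnessLib

/-!
# Trilinear forms with Kloosterman fractions: Bettin–Chandee §7 (the range `M < N` by reciprocity)

Topic `NumberTheory/LFunctions`.  S. Bettin, V. Chandee, *Trilinear forms with Kloosterman
fractions*, Adv. Math. 328 (2018), §7 "Completion of the proof of Theorem 1": from (7.1)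
(= §§2–6) one has, for `M ≥ N`,
(7.2) `𝓑(M,N,A) ≪ ‖α‖‖β‖‖ν‖(MN)^ε(1+|ϑ|A/(MN))^{1/4}(A^{1/2}M^{1/2}N^{3/8} + A^{7/20}M^{3/5}N^{7/20})`,
"which is Theorem 1 in the range `M ≥ N`"; by Remark 2 the same holds, with exponent `1/2` and
`|ϑ|A + X` in place of `|ϑ|A`, for the twisted forms `𝓑(f;M,N,A)` (7.3); and "the elementary
reciprocity law allows us to write `𝓑(M,N,A) = ∑∑∑ α_m β_n ν_a e(-ϑa n̄/m + ϑa/(mn))`.  Thus, if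
`M < N` we can apply (7.3) with the role of `M` and `N` switched and with `f_{a,ϑ}(x,y) = ϑa/(xy)`
… and so the proof of Theorem 1 is complete."

This file PROVES that last step for the trilinear form of the named fact
`BettinChandee2018_trilinearKloostermanFractions` (`BettinChandee2018TrilinearKloostermanFractions.lean`),
in the style of the tree's single-numerator `KloostermanFractionsReciprocity.lean`:

* **`BettinChandee2018_trilinearKloostermanFractions_of_twisted73_MgeN`** — hypothesis: (7.3) in
  the range `1/2 ≤ N ≤ M`, `A ≥ 1/2`, for the twists `e(ηa/(mn))` (`η` real; only `η ∈ {0, ϑ}`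
  after `ϑ ↦ -ϑ` is used), written out in the tree's conventions and with the harmless factor
  `((1+|ϑ|+|η|)AMN)^ε` in place of the source's `(MN)^ε` (the source works under
  "`A, b, ϑ, N ≪ M^C`", §3, and removes it at the end of §6 because the bound "is trivial
  otherwise" — done here by `BC_trivial_range`); conclusion: the named fact, all `M, N, A ≥ 1/2`;
* **`BettinChandee2018_trilinearKloostermanFractions_of_C1A_bound`** — composed with
  `BC_twisted73_MgeN_of_C1A_bound` (`TrilinearKloostermanFractionsFromC1.lean`: §2 coprime
  reduction, Cauchy–Schwarz in `m`, (7.1) ⟹ (7.3)): the named fact from the (6.4)-type bound for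
  the twisted trilinear second moment `𝓒₁^{tw}(M,N,A)` (`β` coprime to `ϑ`, `M ≥ N`);
* **`BettinChandee2018_trilinearKloostermanFractions_of_CbA_bound`** — composed further with
  `BC_C1A_bound_of_CbA_bound` (`TrilinearKloostermanFractionsFromCb.lean`: §6, squarefull
  removal and the Weil range): the named fact from the (5.2)-type bound for the twisted trilinear
  `𝓒_b`-moments with a FIXED squarefull `b` (general `A`);
* **`BettinChandee2018_trilinearKloostermanFractions_of_diagA_offA`** — composed further with
  `BC_CbA_bound_of_diagA_offA` (`TrilinearKloostermanFractionsFrom51.lean`: §2 amplification and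
  §5, (2.2)+(3.5)+(4.25) ⟹ (5.1) ⟹ (5.2), using `TrilinearKloostermanFractionsOptimiseL.lean`): the
  named fact from bounds of the shapes (3.5) (diagonal) and (4.25) (off-diagonal) for the
  amplified, twisted trilinear moments.
So, for the named fact, what remains of the source is exactly §3 (the diagonal terms, (3.5), via
Weil's bound) and §4 (the off-diagonal terms, (4.25)) for the general-`A`, twisted amplified moment
with a fixed squarefull `b` — the hypotheses `hD`, `hO` of `BC_CbA_bound_of_diagA_offA` (the tree's
`KloostermanFractions*.lean` treat `A = 1` untwisted).  No new named facts are introduced (D-0026).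

## References

* S. Bettin, V. Chandee, *Trilinear forms with Kloosterman fractions*, Adv. Math. 328 (2018)
  1234–1262, arXiv:1502.00769, Theorem 1, §7 ((7.2), (7.3), Remark 2). [BettinChandee2018]
-/

noncomputable section

open Finset Real

namespace Literature.NumberTheory.LFunctions

/-- **Bettin–Chandee, §7 (completion of the proof of Theorem 1) for the trilinear form.**
Hypothesis = Bettin–Chandee (7.2)–(7.3) (Theorem 1 in the range `M ≥ N` together with its twisted
form of Remark 2 for the twists `f_{a}(x,y) = ηa/(xy)`, `X = |η|A`), written out in the tree's
conventions and allowing the harmless factor `((1+|ϑ|+|η|)AMN)^ε` (the source's `M^ε` under its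
standing assumption "`A, b, ϑ, N ≪ M^C`", §3): for every `ε > 0` there is `K` with, for all
`1/2 ≤ N ≤ M`, `A ≥ 1/2`, `ϑ ≠ 0`, real `η` and all `α, β, ν` on the dyadic boxes,
`|∑_a∑_m∑_{n,(m,n)=1} α_m β_n ν_a e(ϑa m̄/n + ηa/(mn))| ≤ K ‖α‖‖β‖‖ν‖ ((1+|ϑ|+|η|)AMN)^ε
(1 + (|ϑ|+|η|)A/(MN))^{1/2} (A^{1/2}M^{1/2}N^{3/8} + A^{7/20}M^{3/5}N^{7/20})`.
Conclusion: the named fact `BettinChandee2018_trilinearKloostermanFractions` (all `M, N, A ≥ 1/2`).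
Proof as printed: for `|ϑ| > 64(AMN)²` the bound is trivial (`BC_trivial_range`,
`BC_trilinear_trivial_bound`); otherwise `((1+2|ϑ|)AMN)^{ε/3} ≤ 192^{ε/3}(AMN)^ε`; for `N ≤ M`
take `η = 0` and compare exponents (`BC_terms73_le`); for `M < N` "the elementary reciprocity law
allows us to write `𝓑(M,N,A) = ∑∑∑ α_m β_n ν_a e(-ϑa n̄/m + ϑa/(mn))`. Thus … we can apply (7.3)
with the role of `M` and `N` switched and with `f_{a,ϑ}(x,y) = ϑa/(xy)`"
(`BC_trilinear_eq_swap`, the hypothesis at `(N, M, A, -ϑ, η = ϑ)`, `(1+2|ϑ|A/MN)^{1/2} ≤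
√2 (1+|ϑ|A/MN)^{1/2}`). [cite: BettinChandee2018, §7 and Remark 2] -/
theorem BettinChandee2018_trilinearKloostermanFractions_of_twisted73_MgeN
    (h73 : ∀ ε : ℝ, 0 < ε → ∃ K : ℝ, 0 < K ∧
      ∀ (M N A : ℝ), 1 / 2 ≤ N → N ≤ M → 1 / 2 ≤ A → ∀ (ϑ : ℤ), ϑ ≠ 0 → ∀ (η : ℝ)
        (α β ν : ℕ → ℂ),
        (∀ m : ℕ, α m ≠ 0 → M < m ∧ (m : ℝ) ≤ 2 * M) →
        (∀ n : ℕ, β n ≠ 0 → N < n ∧ (n : ℝ) ≤ 2 * N) →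
        (∀ a : ℕ, ν a ≠ 0 → A < a ∧ (a : ℝ) ≤ 2 * A) →
        ‖∑ a ∈ Icc 1 ⌊2 * A⌋₊, ∑ m ∈ Icc 1 ⌊2 * M⌋₊, ∑ n ∈ Icc 1 ⌊2 * N⌋₊,
            if m.Coprime n then
              α m * β n * ν a * Complex.exp (2 * Real.pi * Complex.I *
                ((ϑ : ℂ) * (a : ℂ) * ((((m : ZMod n)⁻¹).val : ℕ) : ℂ) / (n : ℂ) +
                  (η : ℂ) * (a : ℂ) / ((m : ℂ) * (n : ℂ))))
            else 0‖ ≤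
          K * Real.sqrt (∑ m ∈ Icc 1 ⌊2 * M⌋₊, ‖α m‖ ^ 2) *
            Real.sqrt (∑ n ∈ Icc 1 ⌊2 * N⌋₊, ‖β n‖ ^ 2) *
            Real.sqrt (∑ a ∈ Icc 1 ⌊2 * A⌋₊, ‖ν a‖ ^ 2) *
            ((1 + |(ϑ : ℝ)| + |η|) * (A * M * N)) ^ ε *
            (1 + (|(ϑ : ℝ)| + |η|) * A / (M * N)) ^ (1 / 2 : ℝ) *
            (A ^ (1 / 2 : ℝ) * M ^ (1 / 2 : ℝ) * N ^ (3 / 8 : ℝ) +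
              A ^ (7 / 20 : ℝ) * M ^ (3 / 5 : ℝ) * N ^ (7 / 20 : ℝ))) :
    BettinChandee2018_trilinearKloostermanFractions := by
  intro ε hε
  obtain ⟨K, hK, hB⟩ := h73 (ε / 3) (by positivity)
  refine ⟨Real.sqrt 2 * (192 : ℝ) ^ (ε / 3) * K + (8 : ℝ) ^ (ε + 2), by positivity, ?_⟩
  intro M N A hM hN hA ϑ hϑ α β ν hα hβ hν
  have hM0 : 0 < M := by linarith
  have hN0 : 0 < N := by linarith
  have hA0 : 0 < A := by linarith
  have hP0 : 0 < A * M * N := by positivity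
  set nα := Real.sqrt (∑ m ∈ Icc 1 ⌊2 * M⌋₊, ‖α m‖ ^ 2) with hnα
  set nβ := Real.sqrt (∑ n ∈ Icc 1 ⌊2 * N⌋₊, ‖β n‖ ^ 2) with hnβ
  set nν := Real.sqrt (∑ a ∈ Icc 1 ⌊2 * A⌋₊, ‖ν a‖ ^ 2) with hnν
  have hnα0 : 0 ≤ nα := Real.sqrt_nonneg _
  have hnβ0 : 0 ≤ nβ := Real.sqrt_nonneg _
  have hnν0 : 0 ≤ nν := Real.sqrt_nonneg _
  set W : ℝ := (1 + |(ϑ : ℝ)| * A / (M * N)) ^ (1 / 2 : ℝ) with hW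
  have hW0 : 0 ≤ W := by positivity
  set RHS : ℝ := (A * M * N) ^ (7 / 20 + ε) * (M + N) ^ (1 / 4 : ℝ) +
    (A * M * N) ^ (3 / 8 + ε) * (A * N + A * M) ^ (1 / 8 : ℝ) with hRHS
  have hRHS0 : 0 ≤ RHS := by positivity
  have hϑ1 : (1 : ℝ) ≤ |(ϑ : ℝ)| := by
    rw [← Int.cast_abs]; exact_mod_cast Int.one_le_abs hϑ
  have hK1 : 0 ≤ Real.sqrt 2 * (192 : ℝ) ^ (ε / 3) * K := by positivity
  have hK2 : 0 ≤ (8 : ℝ) ^ (ε + 2) := by positivity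
  rcases lt_or_ge (64 * (A * M * N) ^ 2) |(ϑ : ℝ)| with hbig | hsmall
  · -- the trivial range `|ϑ| > 64 (AMN)²`
    have htriv := BC_trilinear_trivial_bound hM0.le hN0.le hA0.le ϑ α β ν
    have hrange := BC_trivial_range hε hM hN hA hbig
    calc _ ≤ _ := htriv
      _ = (Real.sqrt 8 * Real.sqrt (A * M * N)) * (nα * nβ * nν) := by ring
      _ ≤ ((8 : ℝ) ^ (ε + 2) * W * RHS) * (nα * nβ * nν) := by gcongr
      _ ≤ ((Real.sqrt 2 * (192 : ℝ) ^ (ε / 3) * K + (8 : ℝ) ^ (ε + 2)) * W * RHS) *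
            (nα * nβ * nν) := by gcongr; exact le_add_of_nonneg_left hK1
      _ = _ := by ring
  · -- `|ϑ| ≤ 64 (AMN)²`
    rcases le_or_gt N M with hNM | hMN
    · -- `N ≤ M`: the hypothesis at `η = 0`
      have h1 := hB M N A hN hNM hA ϑ hϑ 0 α β ν hα hβ hν
      rw [BC_trilinear_twisted_zero, abs_zero, add_zero, add_zero] at h1
      have heps : ((1 + |(ϑ : ℝ)|) * (A * M * N)) ^ (ε / 3) ≤
          (192 : ℝ) ^ (ε / 3) * (A * M * N) ^ ε := by
        have := BC_eps_factor_le (s := 0) hP0 hε.le hϑ1 le_rfl (abs_nonneg _) hsmall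
        simpa only [add_zero] using this
      have h73 := BC_terms73_le ε hA0 hM0 hN0
      calc _ ≤ _ := h1
        _ = K * (nα * nβ * nν) * ((1 + |(ϑ : ℝ)|) * (A * M * N)) ^ (ε / 3) * W *
            (A ^ (1 / 2 : ℝ) * M ^ (1 / 2 : ℝ) * N ^ (3 / 8 : ℝ) +
              A ^ (7 / 20 : ℝ) * M ^ (3 / 5 : ℝ) * N ^ (7 / 20 : ℝ)) := by
            rw [hW]; ring
        _ ≤ K * (nα * nβ * nν) * ((192 : ℝ) ^ (ε / 3) * (A * M * N) ^ ε) * W *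
            (A ^ (1 / 2 : ℝ) * M ^ (1 / 2 : ℝ) * N ^ (3 / 8 : ℝ) +
              A ^ (7 / 20 : ℝ) * M ^ (3 / 5 : ℝ) * N ^ (7 / 20 : ℝ)) := by gcongr
        _ = (192 : ℝ) ^ (ε / 3) * K * (nα * nβ * nν) * W *
            ((A * M * N) ^ ε * (A ^ (1 / 2 : ℝ) * M ^ (1 / 2 : ℝ) * N ^ (3 / 8 : ℝ) +
              A ^ (7 / 20 : ℝ) * M ^ (3 / 5 : ℝ) * N ^ (7 / 20 : ℝ))) := by
            ring
        _ ≤ (192 : ℝ) ^ (ε / 3) * K * (nα * nβ * nν) * W * RHS := by gcongr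
        _ ≤ (Real.sqrt 2 * (192 : ℝ) ^ (ε / 3) * K + (8 : ℝ) ^ (ε + 2)) *
            (nα * nβ * nν) * W * RHS := by
            gcongr
            have h2 : (1 : ℝ) ≤ Real.sqrt 2 := by
              rw [Real.le_sqrt (by norm_num) (by norm_num)]; norm_num
            calc (192 : ℝ) ^ (ε / 3) * K = 1 * ((192 : ℝ) ^ (ε / 3) * K) := by ring
              _ ≤ Real.sqrt 2 * ((192 : ℝ) ^ (ε / 3) * K) := by gcongr
              _ = Real.sqrt 2 * (192 : ℝ) ^ (ε / 3) * K := by ring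
              _ ≤ _ := le_add_of_nonneg_right hK2
        _ = _ := by ring
    · -- `M < N`: reciprocity, then the hypothesis at `(N, M, A, -ϑ, η = ϑ)`
      rw [BC_trilinear_eq_swap]
      have h2 := hB N M A hM hMN.le hA (-ϑ) (neg_ne_zero.mpr hϑ) (ϑ : ℝ) β α ν hβ hα hν
      have habs : |((-ϑ : ℤ) : ℝ)| = |(ϑ : ℝ)| := by rw [Int.cast_neg, abs_neg]
      rw [habs] at h2
      have heps : ((1 + |(ϑ : ℝ)| + |(ϑ : ℝ)|) * (A * N * M)) ^ (ε / 3) ≤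
          (192 : ℝ) ^ (ε / 3) * (A * M * N) ^ ε := by
        have := BC_eps_factor_le (s := |(ϑ : ℝ)|) hP0 hε.le hϑ1 (abs_nonneg _) le_rfl hsmall
        rw [show A * N * M = A * M * N by ring]
        exact this
      have hWW : (1 + (|(ϑ : ℝ)| + |(ϑ : ℝ)|) * A / (N * M)) ^ (1 / 2 : ℝ) ≤ Real.sqrt 2 * W := by
        have hx : 0 ≤ |(ϑ : ℝ)| * A / (M * N) := by positivity
        have e : (|(ϑ : ℝ)| + |(ϑ : ℝ)|) * A / (N * M) =
            |(ϑ : ℝ)| * A / (M * N) + |(ϑ : ℝ)| * A / (M * N) := by ring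
        rw [e, hW]
        exact BC_W_two_le hx
      have h73 := BC_terms73_le ε hA0 hN0 hM0
      have eR : (A * N * M) ^ (7 / 20 + ε) * (N + M) ^ (1 / 4 : ℝ) +
          (A * N * M) ^ (3 / 8 + ε) * (A * M + A * N) ^ (1 / 8 : ℝ) = RHS := by
        rw [hRHS, show A * N * M = A * M * N by ring, add_comm N M, add_comm (A * M) (A * N)]
      rw [eR] at h73
      calc _ ≤ _ := h2
        _ = K * (nα * nβ * nν) * ((1 + |(ϑ : ℝ)| + |(ϑ : ℝ)|) * (A * N * M)) ^ (ε / 3) *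
            (1 + (|(ϑ : ℝ)| + |(ϑ : ℝ)|) * A / (N * M)) ^ (1 / 2 : ℝ) *
            (A ^ (1 / 2 : ℝ) * N ^ (1 / 2 : ℝ) * M ^ (3 / 8 : ℝ) +
              A ^ (7 / 20 : ℝ) * N ^ (3 / 5 : ℝ) * M ^ (7 / 20 : ℝ)) := by ring
        _ ≤ K * (nα * nβ * nν) * ((192 : ℝ) ^ (ε / 3) * (A * M * N) ^ ε) * (Real.sqrt 2 * W) *
            (A ^ (1 / 2 : ℝ) * N ^ (1 / 2 : ℝ) * M ^ (3 / 8 : ℝ) +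
              A ^ (7 / 20 : ℝ) * N ^ (3 / 5 : ℝ) * M ^ (7 / 20 : ℝ)) := by gcongr
        _ = Real.sqrt 2 * (192 : ℝ) ^ (ε / 3) * K * (nα * nβ * nν) * W *
            ((A * N * M) ^ ε * (A ^ (1 / 2 : ℝ) * N ^ (1 / 2 : ℝ) * M ^ (3 / 8 : ℝ) +
              A ^ (7 / 20 : ℝ) * N ^ (3 / 5 : ℝ) * M ^ (7 / 20 : ℝ))) := by
            rw [show A * N * M = A * M * N by ring]; ring
        _ ≤ Real.sqrt 2 * (192 : ℝ) ^ (ε / 3) * K * (nα * nβ * nν) * W * RHS := by gcongr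
        _ ≤ (Real.sqrt 2 * (192 : ℝ) ^ (ε / 3) * K + (8 : ℝ) ^ (ε + 2)) *
            (nα * nβ * nν) * W * RHS := by
            gcongr; exact le_add_of_nonneg_right hK2
        _ = _ := by ring

/-- **The named fact from the (6.4)-type bound for the twisted trilinear second moment**
(Bettin–Chandee (6.4) with Remark 2, general `A`, written out: for every `ε > 0` there is `K`
with, for `1/2 ≤ N ≤ M`, `A ≥ 1/2`, `ϑ ≠ 0`, real `η`, `β` on `(N,2N]` coprime to `ϑ`, `ν` on
`(A,2A]`,
`∑_{M<m≤2M} |∑_a ∑_{n,(m,n)=1} β_n ν_a e(ϑ a m̄/n + η a/(mn))|² ≤ K ‖β‖²‖ν‖² ((1+|ϑ|+|η|)AMN)^ε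
(1 + (|ϑ|+|η|)A/(MN)) (AMN^{3/4} + AN^{7/4} + A^{2/5}M^{6/5}N^{7/10} + A^{7/10}M^{3/5}N^{13/10})`)
— via `BC_twisted73_MgeN_of_C1A_bound` (§2 and (7.1) ⟹ (7.3)) and
`BettinChandee2018_trilinearKloostermanFractions_of_twisted73_MgeN` (§7).  This isolates what
remains to be proved of the source for the named fact: §2 (amplification) – §6, twisted, general
`A`. [cite: BettinChandee2018, §§2, 6, 7] -/
theorem BettinChandee2018_trilinearKloostermanFractions_of_C1A_bound
    (hC : ∀ ε : ℝ, 0 < ε → ∃ K : ℝ, 0 < K ∧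
      ∀ (M N A : ℝ), 1 / 2 ≤ N → N ≤ M → 1 / 2 ≤ A → ∀ (ϑ : ℤ), ϑ ≠ 0 → ∀ (η : ℝ)
        (β ν : ℕ → ℂ),
        (∀ n : ℕ, β n ≠ 0 → N < n ∧ (n : ℝ) ≤ 2 * N) →
        (∀ a : ℕ, ν a ≠ 0 → A < a ∧ (a : ℝ) ≤ 2 * A) →
        (∀ n : ℕ, β n ≠ 0 → n.Coprime ϑ.natAbs) →
        ∑ m ∈ Ioc ⌊M⌋₊ ⌊2 * M⌋₊, ‖∑ a ∈ Icc 1 ⌊2 * A⌋₊, ∑ n ∈ Icc 1 ⌊2 * N⌋₊,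
            (if m.Coprime n then
              β n * ν a * Complex.exp (2 * Real.pi * Complex.I *
                ((ϑ : ℂ) * (a : ℂ) * ((((m : ZMod n)⁻¹).val : ℕ) : ℂ) / (n : ℂ) +
                  (η : ℂ) * (a : ℂ) / ((m : ℂ) * (n : ℂ))))
            else 0)‖ ^ 2 ≤
          K * (∑ n ∈ Icc 1 ⌊2 * N⌋₊, ‖β n‖ ^ 2) * (∑ a ∈ Icc 1 ⌊2 * A⌋₊, ‖ν a‖ ^ 2) *
            ((1 + |(ϑ : ℝ)| + |η|) * (A * M * N)) ^ ε *
            (1 + (|(ϑ : ℝ)| + |η|) * A / (M * N)) *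
            (A * M * N ^ (3 / 4 : ℝ) + A * N ^ (7 / 4 : ℝ) +
              A ^ (2 / 5 : ℝ) * M ^ (6 / 5 : ℝ) * N ^ (7 / 10 : ℝ) +
              A ^ (7 / 10 : ℝ) * M ^ (3 / 5 : ℝ) * N ^ (13 / 10 : ℝ))) :
    BettinChandee2018_trilinearKloostermanFractions :=
  BettinChandee2018_trilinearKloostermanFractions_of_twisted73_MgeN
    (BC_twisted73_MgeN_of_C1A_bound hC)

/-- **The named fact from the (5.2)-type bound for the twisted trilinear `𝓒_b`-moments**
(Bettin–Chandee (5.2) with Remark 2, general `A`, fixed squarefull `b`; the hypothesis of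
`BC_C1A_bound_of_CbA_bound`, `TrilinearKloostermanFractionsFromCb.lean`) — via §6
(`BC_C1A_bound_of_CbA_bound`), §2/§7 (`BC_twisted73_MgeN_of_C1A_bound`) and §7
(`BettinChandee2018_trilinearKloostermanFractions_of_twisted73_MgeN`).  This isolates what remains
to be proved of the source for the named fact: §2 (amplification) – §5, twisted, general `A`.
[cite: BettinChandee2018, §§2–7] -/
theorem BettinChandee2018_trilinearKloostermanFractions_of_CbA_bound
    (h52 : ∀ ε : ℝ, 0 < ε → ∃ K : ℝ, 0 < K ∧ ∀ (b : ℕ), 0 < b → (∀ p ∈ b.primeFactors, p ^ 2 ∣ b) →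
      ∀ (M N' A : ℝ), 1 / 2 ≤ M → 1 / 2 ≤ N' → (b : ℝ) ≤ N' → (b : ℝ) * N' ≤ M → 1 / 2 ≤ A →
      ∀ (ϑ : ℤ), ϑ ≠ 0 → b.Coprime ϑ.natAbs → ∀ (η : ℝ) (γ ν : ℕ → ℂ),
        (∀ n : ℕ, γ n ≠ 0 → N' < n ∧ (n : ℝ) ≤ 2 * N') →
        (∀ n : ℕ, γ n ≠ 0 → Squarefree n ∧ n.Coprime b ∧ n.Coprime ϑ.natAbs) →
        (∀ a : ℕ, ν a ≠ 0 → A < a ∧ (a : ℝ) ≤ 2 * A) →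
        ∑ m ∈ (Ioc ⌊M⌋₊ ⌊2 * M⌋₊).filter (fun m => m.Coprime b),
            ‖∑ n' ∈ (Icc 1 ⌊2 * N'⌋₊).filter (fun n' => n'.Coprime m),
              γ n' * ∑ a ∈ Icc 1 ⌊2 * A⌋₊, ν a * Complex.exp (2 * Real.pi * Complex.I *
                ((ϑ : ℂ) * (a : ℂ) * ((((m : ZMod (b * n'))⁻¹).val : ℕ) : ℂ) / ((b * n' : ℕ) : ℂ) +
                  (η : ℂ) * (a : ℂ) / ((m : ℂ) * ((b * n' : ℕ) : ℂ))))‖ ^ 2 ≤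
          K * (∑ n ∈ Icc 1 ⌊2 * N'⌋₊, ‖γ n‖ ^ 2) * (∑ a ∈ Icc 1 ⌊2 * A⌋₊, ‖ν a‖ ^ 2) *
            ((1 + |(ϑ : ℝ)| + |η|) * ((b : ℝ) * M * N' * A)) ^ ε *
            (1 + (|(ϑ : ℝ)| + |η|) * A / ((b : ℝ) * N' * M)) *
            (A * M * ((b : ℝ) * N') ^ (1 / 2 : ℝ) +
              (b : ℝ) ^ (3 / 4 : ℝ) * A * M ^ (1 / 2 : ℝ) * N' ^ (5 / 4 : ℝ) +
              A * M ^ (6 / 5 : ℝ) * N' ^ (1 / 10 : ℝ) * (b : ℝ) ^ (-(2 / 5) : ℝ) +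
              (b : ℝ) ^ (1 / 5 : ℝ) * A ^ (2 / 5 : ℝ) * M ^ (6 / 5 : ℝ) * N' ^ (7 / 10 : ℝ) +
              A ^ (7 / 10 : ℝ) * (b : ℝ) ^ (1 / 2 : ℝ) * M ^ (3 / 5 : ℝ) * N' ^ (13 / 10 : ℝ) +
              (b : ℝ) ^ (1 / 2 : ℝ) * A * N' ^ (7 / 4 : ℝ))) :
    BettinChandee2018_trilinearKloostermanFractions :=
  BettinChandee2018_trilinearKloostermanFractions_of_C1A_bound (BC_C1A_bound_of_CbA_bound h52)

/-- **The named fact from the diagonal bound (3.5) and the off-diagonal bound (4.25)** for the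
amplified, twisted trilinear `𝓒_b`-moments (general `A`; the hypotheses `hD`, `hO` of
`BC_CbA_bound_of_diagA_offA`, `TrilinearKloostermanFractionsFrom51.lean`) — via §§2, 5
(`BC_CbA_bound_of_diagA_offA`), §6 (`BC_C1A_bound_of_CbA_bound`), §§2, 7
(`BC_twisted73_MgeN_of_C1A_bound`, `BettinChandee2018_trilinearKloostermanFractions_of_twisted73_MgeN`).
This isolates what remains to be proved of the source for the named fact: §3 and §4 (Weil's bound
on the diagonal; the off-diagonal analysis), general `A`, twisted. [cite: BettinChandee2018, §§2–7] -/
theorem BettinChandee2018_trilinearKloostermanFractions_of_diagA_offA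
    (hD : ∀ ε : ℝ, 0 < ε → ∃ K : ℝ, 0 < K ∧ ∀ (b : ℕ), 0 < b → (∀ p ∈ b.primeFactors, p ^ 2 ∣ b) →
      ∀ (M N' A : ℝ), 1 / 2 ≤ M → 1 / 2 ≤ N' → (b : ℝ) ≤ N' → (b : ℝ) * N' ≤ M → 1 / 2 ≤ A →
      ∀ (ϑ : ℤ), ϑ ≠ 0 → b.Coprime ϑ.natAbs → ∀ (η : ℝ) (γ ν : ℕ → ℂ),
        (∀ n : ℕ, γ n ≠ 0 → N' < n ∧ (n : ℝ) ≤ 2 * N') →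
        (∀ n : ℕ, γ n ≠ 0 → Squarefree n ∧ n.Coprime b ∧ n.Coprime ϑ.natAbs) →
        (∀ a : ℕ, ν a ≠ 0 → A < a ∧ (a : ℝ) ≤ 2 * A) →
        ∀ L : ℕ, 1 ≤ L →
        ‖∑ m ∈ (Ioc ⌊M⌋₊ ⌊2 * M⌋₊).filter (fun m => m.Coprime b), ∑ ℓ₁ ∈ ((Ioc L (2 * L)).filter (fun ℓ => ℓ.Prime ∧ ℓ.Coprime b ∧ ℓ.Coprime ϑ.natAbs)), ∑ n₁ ∈ Icc 1 ⌊2 * N'⌋₊,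
          ∑ ℓ₂ ∈ ((Ioc L (2 * L)).filter (fun ℓ => ℓ.Prime ∧ ℓ.Coprime b ∧ ℓ.Coprime ϑ.natAbs)), ∑ n₂ ∈ Icc 1 ⌊2 * N'⌋₊,
            (if ℓ₁ * n₁ = ℓ₂ * n₂ then
            (if (ℓ₂ * n₂).Coprime m ∧ ((ℓ₁ * n₁ : ℕ) : ZMod m) = ((ℓ₂ * n₂ : ℕ) : ZMod m) then
              (γ n₁ * ∑ a ∈ Icc 1 ⌊2 * A⌋₊, ν a * Complex.exp (2 * Real.pi * Complex.I *
                ((ϑ : ℂ) * (a : ℂ) * ((((m : ZMod (b * n₁))⁻¹).val : ℕ) : ℂ) / ((b * n₁ : ℕ) : ℂ) +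
                  (η : ℂ) * (a : ℂ) / ((m : ℂ) * ((b * n₁ : ℕ) : ℂ))))) *
              (starRingEnd ℂ) (γ n₂ * ∑ a ∈ Icc 1 ⌊2 * A⌋₊, ν a * Complex.exp (2 * Real.pi * Complex.I *
                ((ϑ : ℂ) * (a : ℂ) * ((((m : ZMod (b * n₂))⁻¹).val : ℕ) : ℂ) / ((b * n₂ : ℕ) : ℂ) +
                  (η : ℂ) * (a : ℂ) / ((m : ℂ) * ((b * n₂ : ℕ) : ℂ))))) else 0) else 0)‖ ≤
          K * (∑ n ∈ Icc 1 ⌊2 * N'⌋₊, ‖γ n‖ ^ 2) * (∑ a ∈ Icc 1 ⌊2 * A⌋₊, ‖ν a‖ ^ 2) *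
            ((1 + |(ϑ : ℝ)| + |η|) * ((b : ℝ) * M * N' * A)) ^ ε * (1 + (|(ϑ : ℝ)| + |η|) * A / ((b : ℝ) * N' * M)) *
            ((L : ℝ) * (A * ((b : ℝ) * (L : ℝ) * N') ^ (1 / 2 : ℝ) + A * M / ((b : ℝ) * N') + M)))
    (hO : ∀ ε : ℝ, 0 < ε → ∃ K : ℝ, 0 < K ∧ ∀ (b : ℕ), 0 < b → (∀ p ∈ b.primeFactors, p ^ 2 ∣ b) →
      ∀ (M N' A : ℝ), 1 / 2 ≤ M → 1 / 2 ≤ N' → (b : ℝ) ≤ N' → (b : ℝ) * N' ≤ M → 1 / 2 ≤ A →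
      ∀ (ϑ : ℤ), ϑ ≠ 0 → b.Coprime ϑ.natAbs → ∀ (η : ℝ) (γ ν : ℕ → ℂ),
        (∀ n : ℕ, γ n ≠ 0 → N' < n ∧ (n : ℝ) ≤ 2 * N') →
        (∀ n : ℕ, γ n ≠ 0 → Squarefree n ∧ n.Coprime b ∧ n.Coprime ϑ.natAbs) →
        (∀ a : ℕ, ν a ≠ 0 → A < a ∧ (a : ℝ) ≤ 2 * A) →
        ∀ L : ℕ, 1 ≤ L →
        ‖∑ m ∈ (Ioc ⌊M⌋₊ ⌊2 * M⌋₊).filter (fun m => m.Coprime b), ∑ ℓ₁ ∈ ((Ioc L (2 * L)).filter (fun ℓ => ℓ.Prime ∧ ℓ.Coprime b ∧ ℓ.Coprime ϑ.natAbs)), ∑ n₁ ∈ Icc 1 ⌊2 * N'⌋₊,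
          ∑ ℓ₂ ∈ ((Ioc L (2 * L)).filter (fun ℓ => ℓ.Prime ∧ ℓ.Coprime b ∧ ℓ.Coprime ϑ.natAbs)), ∑ n₂ ∈ Icc 1 ⌊2 * N'⌋₊,
            (if ℓ₁ * n₁ = ℓ₂ * n₂ then 0 else
            (if (ℓ₂ * n₂).Coprime m ∧ ((ℓ₁ * n₁ : ℕ) : ZMod m) = ((ℓ₂ * n₂ : ℕ) : ZMod m) then
              (γ n₁ * ∑ a ∈ Icc 1 ⌊2 * A⌋₊, ν a * Complex.exp (2 * Real.pi * Complex.I *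
                ((ϑ : ℂ) * (a : ℂ) * ((((m : ZMod (b * n₁))⁻¹).val : ℕ) : ℂ) / ((b * n₁ : ℕ) : ℂ) +
                  (η : ℂ) * (a : ℂ) / ((m : ℂ) * ((b * n₁ : ℕ) : ℂ))))) *
              (starRingEnd ℂ) (γ n₂ * ∑ a ∈ Icc 1 ⌊2 * A⌋₊, ν a * Complex.exp (2 * Real.pi * Complex.I *
                ((ϑ : ℂ) * (a : ℂ) * ((((m : ZMod (b * n₂))⁻¹).val : ℕ) : ℂ) / ((b * n₂ : ℕ) : ℂ) +
                  (η : ℂ) * (a : ℂ) / ((m : ℂ) * ((b * n₂ : ℕ) : ℂ))))) else 0))‖ ≤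
          K * (∑ n ∈ Icc 1 ⌊2 * N'⌋₊, ‖γ n‖ ^ 2) * (∑ a ∈ Icc 1 ⌊2 * A⌋₊, ‖ν a‖ ^ 2) *
            ((1 + |(ϑ : ℝ)| + |η|) * ((b : ℝ) * M * N' * A)) ^ ε * (1 + (|(ϑ : ℝ)| + |η|) * A / ((b : ℝ) * N' * M)) *
            ((b : ℝ) ^ (1 / 2 : ℝ) * A * (L : ℝ) * N' ^ (3 / 4 : ℝ) *
              ((b : ℝ) ^ (1 / 4 : ℝ) * N' ^ (1 / 2 : ℝ) * (L : ℝ) ^ (1 / 2 : ℝ) * M ^ (-(1 / 2) : ℝ) +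
                (L : ℝ) ^ (5 / 2 : ℝ) * N' / M + N' ^ (1 / 4 : ℝ) * A ^ (-(1 / 2) : ℝ)))) :
    BettinChandee2018_trilinearKloostermanFractions :=
  BettinChandee2018_trilinearKloostermanFractions_of_CbA_bound (BC_CbA_bound_of_diagA_offA hD hO)

end Literature.NumberTheory.LFunctions

end
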